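import Literature.NumberTheory.NumberFields.CMQuadraticExtension
import HarnessLib

/-!
# `K(√-n)` is a CM field for `K` a CM field

Topic `Literature/NumberTheory/NumberFields`; a *proofs* file (theorems only, no definitions, no
named facts).  Let `K` be a CM number field (Mathlib `NumberField.IsCMField`: totally complex and
quadratic over its maximal real subfield `K⁺`) and `L = K(x)` a number field generated over `K`
by a square root `x` of a negative rational integer, `x² = -n`, `n ≥ 1` (so `L = K` or
`[L : K] = 2`).  Then `L` is again a CM field (`isCMField_of_adjoin_sqrt_neg_eq_top`).  Iterating,
the compositum of a CM field with finitely many imaginary quadratic fields `ℚ(√-n_i)` is CM —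
the bookkeeping "`E = E₀ · E_a · E_b · E_c` […] Then `E/F` is a soluble CM extension" in
Allen–Calegari–Caraiani–Gee–Helm–Le Hung–Newton–Scholze–Taylor–Thorne, proof of Thm. 6.1.1
(arXiv:1812.09999, p. 89), i.e. the hypothesis `IsTotallyReal E ∨ IsCMField E` of the tree's
`Literature.NumberTheory.Automorphic.ACC2023.solubleDescent_isAutomorphic` for that `E`.

Proof (Shimura, *Abelian Varieties with Complex Multiplication*, §18.2; Milne, *Complex
Multiplication*, §1, Prop. 1.4 "a composite of CM fields is CM" — here the special case of an
imaginary quadratic factor, proved from the definition): `L ⊇ K` is totally complex; with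
`c` the complex conjugation of `K` pick `α = y - c(y) ≠ 0`, so that `φ(α)` is purely imaginary for
every embedding `φ` of `K`; then `w = x·α ∈ L` is real under every embedding of `L`, as is `K⁺`,
so the maximal real subfield `L⁺` contains `K⁺(w)`, of degree `2` over `K⁺` (`w ∉ K⁺` as
`x ∉ K`); since `[L : K⁺] = 4` and `L⁺ ≠ L`, `[L : L⁺] = 2`.  The case `x ∈ K` (`L = K`) is the
transport of the CM property along `K ≃ L` (`IsCMField.of_ringEquiv`).

## References

* G. Shimura, *Abelian Varieties with Complex Multiplication and Modular Functions*, Princeton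
  1998, §18.2; J. S. Milne, *Complex Multiplication* (2006), §1 Prop. 1.4. [folklore]
* [ACCGHLNSTT2023] P. B. Allen et al., *Potential automorphy over CM fields*, Ann. of Math. 197
  (2023), §6.5, proof of Thm. 6.1.1 (p. 89 of arXiv:1812.09999).
-/

noncomputable section

open NumberField InfinitePlace Polynomial
open scoped ComplexConjugate

namespace Literature.NumberTheory.NumberFields

/-! ## Transport of the CM property along isomorphisms -/

/-- The maximal real subfield is respected by isomorphisms: `e(K⁺) ⊆ L⁺`. [folklore] -/
theorem ringEquiv_apply_mem_maximalRealSubfield {K L : Type*} [Field K] [Field L]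
    (e : K ≃+* L) {k : K} (hk : k ∈ maximalRealSubfield K) : e k ∈ maximalRealSubfield L :=
  fun θ => hk (θ.comp e.toRingHom)

/-- **A field isomorphic to a CM field is CM.** [folklore] -/
theorem IsCMField.of_ringEquiv {K L : Type*} [Field K] [CharZero K] [IsCMField K] [Field L]
    [CharZero L] (e : K ≃+* L) : IsCMField L := by
  letI : Algebra K L := e.toRingHom.toAlgebra
  haveI : IsTotallyComplex L := isTotallyComplex_of_algebra K L
  -- `e` restricts to `K⁺ ≃ L⁺`
  let i : maximalRealSubfield K ≃+* maximalRealSubfield L :=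
    { toFun := fun k => ⟨e k, ringEquiv_apply_mem_maximalRealSubfield e k.2⟩
      invFun := fun l => ⟨e.symm l, ringEquiv_apply_mem_maximalRealSubfield e.symm l.2⟩
      left_inv := fun k => Subtype.ext (e.symm_apply_apply k)
      right_inv := fun l => Subtype.ext (e.apply_symm_apply l)
      map_mul' := fun _ _ => Subtype.ext (map_mul e _ _)
      map_add' := fun _ _ => Subtype.ext (map_add e _ _) }
  have h2 : Module.finrank (maximalRealSubfield L) L = 2 := by
    rw [← Algebra.IsQuadraticExtension.finrank_eq_two (maximalRealSubfield K) K]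
    exact (Algebra.finrank_eq_of_equiv_equiv i e (by ext; rfl)).symm
  exact { is_quadratic := { finrank_eq_two' := h2 } }

/-! ## Embeddings of a square root of `-n` -/

/-- If `z² = -n` in `ℂ` (`n ≥ 0` real) then `z` is purely imaginary: `conj z = -z`. [folklore] -/
theorem Complex.conj_eq_neg_of_sq_eq_neg {z : ℂ} {n : ℝ} (hn : 0 ≤ n) (hz : z ^ 2 = -(n : ℂ)) :
    conj z = -z := by
  have hre : z.re = 0 := by
    have h1 := congrArg Complex.re hz
    have h2 := congrArg Complex.im hz
    simp only [sq, Complex.mul_re, Complex.mul_im, Complex.neg_re, Complex.ofReal_re,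
      Complex.neg_im, Complex.ofReal_im, neg_zero] at h1 h2
    by_contra hre
    have him : z.im = 0 := by
      have : z.re * z.im = 0 := by linarith
      rcases mul_eq_zero.1 this with h | h
      · exact absurd h hre
      · exact h
    rw [him, mul_zero, sub_zero] at h1
    nlinarith [mul_self_nonneg z.re, sq_nonneg z.re, mul_pos_iff.2 (Or.inl ⟨lt_of_le_of_ne
      (mul_self_nonneg z.re) (Ne.symm (mul_ne_zero hre hre)), lt_of_le_of_ne
      (mul_self_nonneg z.re) (Ne.symm (mul_ne_zero hre hre))⟩)]
  apply Complex.ext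
  · simp [hre]
  · simp

/-! ## The main theorem -/

section Main

variable (K L : Type*) [Field K] [NumberField K] [IsCMField K] [Field L] [NumberField L]
  [Algebra K L]

/-- **`K(√-n)` is CM for `K` CM, the case `√-n ∉ K`.**  Let `K` be a CM number field, `L ⊇ K` a
number field with `L = K(x)`, `x² = -n` (`n ≥ 1`) and `x ∉ K`.  Then `L` is a CM field: `L` is
totally complex; for `α = y - c(y) ≠ 0` (`c` the complex conjugation of `K`) the element
`w = x · α` of `L` and the subfield `K⁺` are real under every complex embedding of `L`, so
`L⁺ ⊇ K⁺(w)` with `[K⁺(w) : K⁺] = 2`; as `[L : K⁺] = 4` and `x ∉ L⁺`, `[L : L⁺] = 2`.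
(Shimura §18.2; Milne, *Complex Multiplication*, Prop. 1.4.) [folklore] -/
theorem isCMField_of_adjoin_sqrt_neg {x : L} {n : ℕ} (hn : 0 < n) (hx2 : x ^ 2 = -(n : L))
    (hxK : x ∉ Set.range (algebraMap K L)) (hgen : IntermediateField.adjoin K {x} = ⊤) :
    IsCMField L := by
  -- `L` is an algebra over `K⁺` through the actions inherited by the subfield `K⁺ ≤ K`
  haveI : IsTotallyComplex L := isTotallyComplex_of_algebra K L
  haveI : FiniteDimensional (maximalRealSubfield K) L :=
    Module.Finite.trans (R := maximalRealSubfield K) K L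
  -- degrees: `[L : K] = 2`, `[L : K⁺] = 4`
  have hxa : x ^ 2 = algebraMap K L (-(n : K)) := by rw [hx2, map_neg, map_natCast]
  have hKL : Module.finrank K L = 2 := by
    rw [← finrank_adjoin_simple_eq_two_of_sq_eq hxa hxK, hgen]
    exact IntermediateField.finrank_top'.symm
  have hKpL : Module.finrank (maximalRealSubfield K) L = 4 := by
    rw [← Module.finrank_mul_finrank (maximalRealSubfield K) K L,
      Algebra.IsQuadraticExtension.finrank_eq_two (maximalRealSubfield K) K, hKL]
  -- an element `α` of `K` on which the complex conjugation acts by `-1`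
  obtain ⟨y, hy⟩ : ∃ y : K, IsCMField.complexConj K y ≠ y := by
    by_contra h
    push Not at h
    exact IsCMField.complexConj_ne_one K
      (AlgEquiv.ext fun z => by rw [AlgEquiv.one_apply]; exact h z)
  set α : K := y - IsCMField.complexConj K y with hα
  have hα0 : α ≠ 0 := sub_ne_zero.2 (Ne.symm hy)
  have hφα : ∀ φ : K →+* ℂ, conj (φ α) = -φ α := fun φ => by
    rw [hα, map_sub, IsCMField.complexEmbedding_complexConj, map_sub, Complex.conj_conj]
    ring
  have hα2 : α ^ 2 ∈ maximalRealSubfield K := fun φ => by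
    rw [RCLike.star_def, map_pow, map_pow, hφα, neg_sq]
  -- the element `w = x · α` of `L`
  set w : L := x * algebraMap K L α with hw
  have hιa : ∀ k : maximalRealSubfield K, algebraMap (maximalRealSubfield K) L k =
      algebraMap K L (k : K) := fun _ => rfl
  have hw2 : w ^ 2 = algebraMap (maximalRealSubfield K) L
      ⟨-(n : K) * α ^ 2, mul_mem (neg_mem (natCast_mem _ n)) hα2⟩ := by
    rw [hιa, hw, mul_pow, hx2, map_mul, map_neg, map_natCast, map_pow]
  have hwK : w ∉ Set.range (algebraMap (maximalRealSubfield K) L) := by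
    rintro ⟨k, hk⟩
    rw [hιa] at hk
    apply hxK
    refine ⟨(k : K) * α⁻¹, ?_⟩
    have hια : algebraMap K L α ≠ 0 := by
      rw [Ne, map_eq_zero_iff _ (algebraMap K L).injective]
      exact hα0
    rw [map_mul, map_inv₀, hk, hw, mul_assoc, mul_inv_cancel₀ hια, mul_one]
  -- `x` and `w` under the complex embeddings of `L`
  have hθx : ∀ θ : L →+* ℂ, conj (θ x) = -θ x := fun θ =>
    Complex.conj_eq_neg_of_sq_eq_neg (n := n) (Nat.cast_nonneg n)
      (by rw [← map_pow, hx2, map_neg, map_natCast, Complex.ofReal_natCast])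
  have hwreal : w ∈ maximalRealSubfield L := fun θ => by
    have h1 : conj (θ (algebraMap K L α)) = -θ (algebraMap K L α) :=
      hφα (θ.comp (algebraMap K L))
    rw [RCLike.star_def, hw, map_mul, map_mul, hθx, h1, neg_mul_neg]
  have hKpreal : ∀ k : maximalRealSubfield K,
      algebraMap (maximalRealSubfield K) L k ∈ maximalRealSubfield L := fun k θ => by
    rw [hιa, ← RingHom.comp_apply]
    exact k.2 (θ.comp (algebraMap K L))
  -- `L⁺` as an intermediate field over `K⁺`, containing `K⁺(w)` of degree `2`
  let Lp : IntermediateField (maximalRealSubfield K) L :=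
    (maximalRealSubfield L).toIntermediateField hKpreal
  have hMle : IntermediateField.adjoin (maximalRealSubfield K) {w} ≤ Lp :=
    IntermediateField.adjoin_simple_le_iff.2 hwreal
  have hM2 : Module.finrank (maximalRealSubfield K)
      (IntermediateField.adjoin (maximalRealSubfield K) {w}) = 2 :=
    finrank_adjoin_simple_eq_two_of_sq_eq hw2 hwK
  have hLp2 : 2 ≤ Module.finrank (maximalRealSubfield K) Lp := by
    rw [← hM2]
    exact LinearMap.finrank_le_finrank_of_injective
      (f := (IntermediateField.inclusion hMle).toLinearMap)
      (IntermediateField.inclusion hMle).injective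
  -- `L⁺ ≠ L` since `x ∉ L⁺`
  have hLplt : Module.finrank (maximalRealSubfield K) Lp < 4 := by
    rw [← hKpL]
    refine lt_of_le_of_ne (LinearMap.finrank_le_finrank_of_injective (f := Lp.val.toLinearMap)
      (RingHom.injective _)) fun heq => ?_
    have htop : Lp = ⊤ :=
      IntermediateField.eq_of_le_of_finrank_eq le_top
        (heq.trans IntermediateField.finrank_top'.symm)
    have hxLp : x ∈ Lp := by rw [htop]; exact IntermediateField.mem_top
    obtain ⟨θ⟩ := (inferInstance : Nonempty (L →+* ℂ))
    have h1 : conj (θ x) = θ x := by rw [← RCLike.star_def]; exact hxLp θ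
    rw [hθx, neg_eq_iff_add_eq_zero, ← two_mul, mul_eq_zero] at h1
    rcases h1 with h1 | h1
    · norm_num at h1
    · have h2 : (θ x) ^ 2 = -(n : ℂ) := by rw [← map_pow, hx2, map_neg, map_natCast]
      rw [h1, zero_pow two_ne_zero] at h2
      have : (n : ℂ) = 0 := by rw [← neg_eq_zero, ← h2]
      exact hn.ne' (by exact_mod_cast this)
  -- tower: `[L⁺ : K⁺] · [L : L⁺] = 4`, so `[L : L⁺] = 2`
  have htower := Module.finrank_mul_finrank (maximalRealSubfield K) Lp L
  rw [hKpL] at htower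
  have hLpL : Module.finrank Lp L = 2 := by
    have hpos : 0 < Module.finrank Lp L := Module.finrank_pos
    interval_cases h : Module.finrank (maximalRealSubfield K) Lp <;> omega
  -- transport from `Lp` to `L⁺` (same subfield) and conclude
  let i : Lp ≃+* maximalRealSubfield L :=
    { toFun := fun z => ⟨z.1, z.2⟩
      invFun := fun z => ⟨z.1, z.2⟩
      left_inv := fun _ => rfl
      right_inv := fun _ => rfl
      map_mul' := fun _ _ => rfl
      map_add' := fun _ _ => rfl }
  have h2 : Module.finrank (maximalRealSubfield L) L = 2 := by
    rw [← hLpL]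
    exact (Algebra.finrank_eq_of_equiv_equiv i (RingEquiv.refl L) (by ext; rfl)).symm
  exact { is_quadratic := { finrank_eq_two' := h2 } }

/-- **`K(√-n)` is a CM field for `K` a CM field** (`L = K(x)`, `x² = -n`, `n ≥ 1`; `L = K` when
`x ∈ K`).  Iterating: the compositum of a CM field with imaginary quadratic fields
`ℚ(√-n₁), …, ℚ(√-n_r)` is CM — in ACC+ 2023, proof of Thm. 6.1.1, `E = E₀ · E_a · E_b · E_c` is
CM for `E₀` CM. (Shimura §18.2; Milne, *Complex Multiplication*, Prop. 1.4: a composite of CM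
fields is CM.)
[cite: ACCGHLNSTT2023, §6.5, proof of Thm. 6.1.1 (p. 89 of arXiv:1812.09999)] -/
theorem isCMField_of_adjoin_sqrt_neg_eq_top {x : L} {n : ℕ} (hn : 0 < n)
    (hx2 : x ^ 2 = -(n : L)) (hgen : IntermediateField.adjoin K {x} = ⊤) : IsCMField L := by
  by_cases hxK : x ∈ Set.range (algebraMap K L)
  · -- `L = K`
    have hbot : (⊥ : IntermediateField K L) = ⊤ := by
      rw [← hgen, eq_comm, IntermediateField.adjoin_simple_eq_bot_iff]
      exact IntermediateField.mem_bot.2 hxK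
    let e : K ≃ₐ[K] L :=
      ((IntermediateField.botEquiv K L).symm.trans (IntermediateField.equivOfEq hbot)).trans
        IntermediateField.topEquiv
    exact IsCMField.of_ringEquiv e.toRingEquiv
  · exact isCMField_of_adjoin_sqrt_neg K L hn hx2 hxK hgen

end Main

end Literature.NumberTheory.NumberFields

end
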